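import Mathlib

/-!
# Poisson-kernel tail mass (solo-informed, session 24; claim C203, sharpest §2e (D12)(ii))

The far-field mass constant of the GM–Poisson localisation: for the half-plane Poisson kernel
`P_η(s) = η / (π (s² + η²))` and `K > 0`,
`∫_{s > K} P_η(s) ds = (1/π)(π/2 - arctan (K/η)) ≤ η / (π K)`,
hence the two-sided far field `{|s| ≥ K}` has `P_η`-mass `ε ≤ 2η/(πK)` — the exponent in
`|F(γ+iη)|² ≤ e^{2aη} M^{ε} (A_K/(1-ε))^{1-ε}`.
-/

namespace Summit.RiemannHypothesis.RiemannHypothesis.Theorems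

open MeasureTheory Set Filter Topology

/-- The primitive `s ↦ (1/π)·arctan (s/η)` of the Poisson kernel `η/(π(s²+η²))` (`η > 0`). -/
theorem hasDerivAt_arctan_div_poisson {η : ℝ} (hη : 0 < η) (s : ℝ) :
    HasDerivAt (fun s : ℝ => (1 / Real.pi) * Real.arctan (s / η))
      (η / (Real.pi * (s ^ 2 + η ^ 2))) s := by
  have h1 : HasDerivAt (fun s : ℝ => s / η) (1 / η) s := (hasDerivAt_id s).div_const η
  have h2 := (Real.hasDerivAt_arctan (s / η)).comp s h1
  have h3 := h2.const_mul (1 / Real.pi)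
  refine h3.congr_deriv ?_
  have hπ : Real.pi ≠ 0 := Real.pi_ne_zero
  have hη0 : η ≠ 0 := hη.ne'
  field_simp
  ring

/-- Tail mass of the Poisson kernel beyond `K`: `∫_{s>K} η/(π(s²+η²)) ds = (1/π)(π/2 - arctan(K/η))`. -/
theorem integral_poisson_Ioi {η K : ℝ} (hη : 0 < η) :
    ∫ s in Ioi K, η / (Real.pi * (s ^ 2 + η ^ 2))
      = (1 / Real.pi) * (Real.pi / 2) - (1 / Real.pi) * Real.arctan (K / η) := by
  have hcont : ContinuousWithinAt (fun s : ℝ => (1 / Real.pi) * Real.arctan (s / η)) (Ici K) K :=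
    ((continuous_const.mul (Real.continuous_arctan.comp (continuous_id.div_const η)))).continuousWithinAt
  have hderiv : ∀ s ∈ Ioi K, HasDerivAt (fun s : ℝ => (1 / Real.pi) * Real.arctan (s / η))
      (η / (Real.pi * (s ^ 2 + η ^ 2))) s := fun s _ => hasDerivAt_arctan_div_poisson hη s
  have hnonneg : ∀ s ∈ Ioi K, 0 ≤ η / (Real.pi * (s ^ 2 + η ^ 2)) := fun s _ => by positivity
  have hlim : Tendsto (fun s : ℝ => (1 / Real.pi) * Real.arctan (s / η)) atTop
      (𝓝 ((1 / Real.pi) * (Real.pi / 2))) := by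
    have ha : Tendsto (fun s : ℝ => Real.arctan (s / η)) atTop (𝓝 (Real.pi / 2)) := by
      have h0 : Tendsto (fun s : ℝ => s / η) atTop atTop := tendsto_id.atTop_div_const hη
      exact (tendsto_nhds_of_tendsto_nhdsWithin Real.tendsto_arctan_atTop).comp h0
    exact ha.const_mul (1 / Real.pi)
  have hint : IntegrableOn (fun s : ℝ => η / (Real.pi * (s ^ 2 + η ^ 2))) (Ioi K) :=
    integrableOn_Ioi_deriv_of_nonneg hcont hderiv hnonneg hlim
  rw [integral_Ioi_of_hasDerivAt_of_tendsto hcont hderiv hint hlim]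

/-- `π/2 - arctan x ≤ 1/x` for `x > 0` (from `arctan x⁻¹ = π/2 - arctan x` and `arctan y < y`). -/
theorem pi_div_two_sub_arctan_le_inv {x : ℝ} (hx : 0 < x) :
    Real.pi / 2 - Real.arctan x ≤ 1 / x := by
  rw [← Real.arctan_inv_of_pos hx, one_div]
  have hy : 0 < x⁻¹ := inv_pos.2 hx
  have h1 : 0 < Real.arctan x⁻¹ := Real.arctan_pos.2 hy
  have h2 : Real.arctan x⁻¹ < Real.pi / 2 := Real.arctan_lt_pi_div_two _
  have := Real.lt_tan h1 h2
  rw [Real.tan_arctan] at this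
  exact this.le

/-- FAR-FIELD MASS BOUND: for `η > 0`, `K > 0`, `∫_{s>K} η/(π(s²+η²)) ds ≤ η/(πK)`; the two-sided
far field `{|s-γ| ≥ K}` of the GM–Poisson localisation therefore has mass `≤ 2η/(πK)`. -/
theorem integral_poisson_Ioi_le {η K : ℝ} (hη : 0 < η) (hK : 0 < K) :
    ∫ s in Ioi K, η / (Real.pi * (s ^ 2 + η ^ 2)) ≤ η / (Real.pi * K) := by
  rw [integral_poisson_Ioi hη, ← mul_sub]
  have hπ : 0 < Real.pi := Real.pi_pos
  have h := pi_div_two_sub_arctan_le_inv (div_pos hK hη)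
  calc (1 / Real.pi) * (Real.pi / 2 - Real.arctan (K / η))
      ≤ (1 / Real.pi) * (1 / (K / η)) := mul_le_mul_of_nonneg_left h (by positivity)
    _ = η / (Real.pi * K) := by field_simp

end Summit.RiemannHypothesis.RiemannHypothesis.Theorems
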